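/-
Copyright (c) 2026 the pub-hodgecm-mathlib formalisation cell (harness21).  Prover seat hodgecm-mathlib-K2Liu-p13 (g4), Track B «K2-LIT»,
#184♮ = hLiu418 = `stmt-HodgeConjecture-24832`; ROAD Φ (RULING «M-156n»), #41 TOP, (β) END file — the ASSEMBLY HALF of the archimedean face `hArch` of ★∕📤
`K2LiuBigCellContinuation.exists_bigCell_continuation_cm`: from a PRESENTATION of the arch flat family as a finite sum of place-pure products of tube sections with fixed
compact pictures (K2Liu-p11's dictionary half `exists_flat_tube_presentation`, typing) to integrability on `{1 < re}` and holomorphy on `{0 < re}` of the arch block — over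
★ p862521 §5 (K2Liu-p03 ∘ K2Liu-p11: `exists_continuation_integral_unipDeltaArch_of_record`, `integrable_prod_unipDeltaArch_of_record`).
THEOREMS ONLY (no `def`, no `instance`, no named-fact hypothesis, no `sorry`).
-/
import Summits.HodgeConjecture.HodgeConjecture.Theorems.K2LiuArchBlockOfFrameEnd     -- ★ p862521 §5 (of record)
import HarnessLib

/-!
# Crux `HLiu418`, ROAD Φ, organ Φ8 (row G6), the archimedean face of the (β) END file — ASSEMBLY HALF: PRESENTATION ⟹ `hArch`

Cell `hodgecm-mathlib`, crux item hLiu418 = `stmt-HodgeConjecture-24832` (helper lane, count-neutral).  Frame letters of ★ `K2LiuHolTubeRigidityOfFrame` §2 and of ★ p862521 §5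
BY VALUE (`T Tinv Fr hFr hT1 hT2 hTU hTiv hTN`, the anti-diagonal reading `hBC` of `(w_Δ)_∞`), any Haar `ν_∞` on `N_Δ(L⁺ ⊗ ℝ)`, odd weights `k`, and a PRESENTATION of a
family `F : ℂ → H_∞ → ℂ`:  `F s a = Σ_{r<m} γ_r(s) · ∏_w Fs s r w (Fr (a·g) w)` with `γ_r` holomorphic on `{0 < re}`, `Fs s r w ∈ I_w(s, χ_{k_w})` and FIXED compact pictures
`cp (Fs s r w) = Q r w` (K2Liu-p11's `exists_flat_tube_presentation` for `F = H_∞^{2(s−s₀)}·A`, `γ_r(s) = c_r·C_g^{2(s−s₀)}`).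
**`archFace_of_presentation`**: for every `κ_∞ ∈ H_∞`, (7a) `∀ s, 1 < re s → Integrable (p ↦ F s ((w_Δ)_∞ · ↑p · κ_∞)) ν_∞` and (7b) `∃ E` holomorphic on `{0 < re}` with
`∫ F s ((w_Δ)_∞ · ↑p · κ_∞) dν_∞(p) = E(s)` for `1 < re s` — the body of `hArch` of 📤 `K2LiuBigCellContinuation` (§5 per summand at the point `κ_∞·g`, `mul_assoc`,
`integral_finset_sum`, `E := Σ_r γ_r · E_r`).
Sources: [Shimura1997, §§5–6, §16.4]; [KudlaRallis1994, §1]; [Tan1999, §3]; [BorelJacquet1979, §4.1].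
HONEST LABEL.  Helper lemmas, count-neutral; `HC_CM` is proved only modulo the 7 printed citations (2 remaining named inputs:
hLiu418 = `stmt-HodgeConjecture-24832`, h413 = `stmt-HodgeConjecture-24833`) until rung 0 closes.
-/

set_option autoImplicit false
set_option linter.dupNamespace false -- the mandated namespace repeats `HodgeConjecture.HodgeConjecture`

noncomputable section

open Complex Matrix MeasureTheory MeasureTheory.Measure NumberField
open scoped ComplexConjugate NNReal
open Literature.NumberTheory.Automorphic Literature.NumberTheory.GelbartRogawski1991 Literature.NumberTheory.GelbartRogawski1991.GRConstruction
open Literature.NumberTheory.K2Lit.SiegelDoubled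
open Summit.HodgeConjecture.HodgeConjecture.Cruxes.HLiu418.K2LiuArchInducedTubeDefs
open Summit.HodgeConjecture.HodgeConjecture.Cruxes.HLiu418.K2LiuU22CompactPictureDefs
open Summit.HodgeConjecture.HodgeConjecture.Cruxes.HLiu418.K2LiuSiegelUnipotentLocalDefs (unipDeltaArch)
open Summit.HodgeConjecture.HodgeConjecture.Cruxes.HLiu418.K2LiuArchBlockOfFrameEnd
  (exists_continuation_integral_unipDeltaArch_of_record integrable_prod_unipDeltaArch_of_record)

namespace Summit.HodgeConjecture.HodgeConjecture.Cruxes.HLiu418.K2LiuArchFaceOfPresentation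

variable (L : Type) [Field L] [NumberField L] [IsCMField L]
variable {N₀ M₀ : ℕ} (e : Fin N₀ × Fin M₀ ≃ Fin 2)
  (dV : Fin N₀ → L) (hdV : ∀ i, IsCMField.complexConj L (dV i) = dV i)
  (dW : Fin M₀ → L) (hdW : ∀ i, IsCMField.complexConj L (dW i) = dW i)
  (T Tinv : {w : InfinitePlace L // w.IsComplex} → Matrix (Fin 2 ⊕ Fin 2) (Fin 2 ⊕ Fin 2) ℂ)
  (Fr : UnitaryGroup.arch (Fp L) L (IsCMField.complexConj L) (2 + 2) (hermD L e dV hdV dW hdW) →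
    {w : InfinitePlace L // w.IsComplex} → Matrix (Fin 2 ⊕ Fin 2) (Fin 2 ⊕ Fin 2) ℂ)
  (hFr : ∀ a w, Fr a w = T w * Matrix.reindex (e₂ (n := 2)).symm (e₂ (n := 2)).symm
    (((UnitaryGroup.archAt (Fp L) L (IsCMField.complexConj L) (2 + 2) (hermD L e dV hdV dW hdW) w
      (UnitaryGroup.complexConj_smul_infinitePlace L w.1) (IsCMField.complexConj_ne_one L) a :
        UnitaryGroup.archLocal L (2 + 2) (hermD L e dV hdV dW hdW) w) : GL (Fin (2 + 2)) ℂ) : Matrix (Fin (2 + 2)) (Fin (2 + 2)) ℂ) * Tinv w)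
  (hT2 : ∀ w, Tinv w * T w = 1)
  (hTU : ∀ w (g : GL (Fin (2 + 2)) ℂ), g ∈ UnitaryGroup.archLocal L (2 + 2) (hermD L e dV hdV dW hdW) w →
    (T w * Matrix.reindex (e₂ (n := 2)).symm (e₂ (n := 2)).symm (g : Matrix _ _ ℂ) * Tinv w)ᴴ * Matrix.J (Fin 2) ℂ *
      (T w * Matrix.reindex (e₂ (n := 2)).symm (e₂ (n := 2)).symm (g : Matrix _ _ ℂ) * Tinv w) = Matrix.J (Fin 2) ℂ)
  [MeasurableSpace ↥(unipDeltaArch L e dV hdV dW hdW)] [BorelSpace ↥(unipDeltaArch L e dV hdV dW hdW)]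
  [Fintype {w : InfinitePlace L // w.IsComplex}]

include hFr hT2 hTU in
/-- **THE ARCHIMEDEAN FACE FROM A PRESENTATION** (assembly half of `hArch`).  Frame letters by value; odd weights `k`; a Haar `ν_∞` on `N_Δ(L⁺ ⊗ ℝ)`; a family
`F : ℂ → H_∞ → ℂ` presented as `F s a = Σ_r γ_r(s)·∏_w Fs s r w (Fr (a·g) w)` with `γ_r` holomorphic on `{0 < re}`, `Fs s r w ∈ I_w(s, χ_{k_w})`, fixed compact pictures
`Q r w`.  Then for every `κ_∞ ∈ H_∞`: `p ↦ F s ((w_Δ)_∞·↑p·κ_∞)` is `ν_∞`-integrable for `1 < re s`, and `∫ F s ((w_Δ)_∞·↑p·κ_∞) dν_∞(p) = E(s)` with `E` holomorphic on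
`{0 < re s}` (★ p862521 §5 per summand at the point `κ_∞·g`; `E := Σ_r γ_r·E_r`). [cite: Shimura1997, §16.4] [cite: KudlaRallis1994, §1] [cite: Tan1999, §3] -/
theorem archFace_of_presentation (hT1 : ∀ w, T w * Tinv w = 1)
    (hTiv : ∀ w (u : GL (Fin (2 + 2)) ℂ), u ∈ UnitaryGroup.archLocal L (2 + 2) (hermD L e dV hdV dW hdW) w →
      K2LiuSiegelUnipotentLocalDefs.IsUnipM (n := 2) (u : Matrix (Fin (2 + 2)) (Fin (2 + 2)) ℂ) →
        ∃ b : Matrix (Fin 2) (Fin 2) ℂ, bᴴ = b ∧ T w * Matrix.reindex (e₂ (n := 2)).symm (e₂ (n := 2)).symm (u : Matrix _ _ ℂ) * Tinv w = fromBlocks 1 b 0 1)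
    (hTN : ∀ w (b : Matrix (Fin 2) (Fin 2) ℂ), bᴴ = b → ∃ u : GL (Fin (2 + 2)) ℂ,
      u ∈ UnitaryGroup.archLocal L (2 + 2) (hermD L e dV hdV dW hdW) w ∧ K2LiuSiegelUnipotentLocalDefs.IsUnipM (n := 2) (u : Matrix (Fin (2 + 2)) (Fin (2 + 2)) ℂ) ∧
        T w * Matrix.reindex (e₂ (n := 2)).symm (e₂ (n := 2)).symm (u : Matrix _ _ ℂ) * Tinv w = fromBlocks 1 b 0 1)
    (νinf : Measure ↥(unipDeltaArch L e dV hdV dW hdW)) [νinf.IsHaarMeasure]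
    (B C : {w : InfinitePlace L // w.IsComplex} → Matrix (Fin 2) (Fin 2) ℂ) (hBC : ∀ w, T w * fromBlocks 1 0 0 (-1) * Tinv w = fromBlocks 0 (B w) (C w) 0)
    (k : {w : InfinitePlace L // w.IsComplex} → ℤ) (hk : ∀ w, Odd (k w))
    {m : ℕ} (Q : Fin m → {w : InfinitePlace L // w.IsComplex} → Carrier)
    (γ : Fin m → ℂ → ℂ) (hγ : ∀ r, DifferentiableOn ℂ (γ r) {s : ℂ | 0 < s.re})
    (Fs : ℂ → Fin m → {w : InfinitePlace L // w.IsComplex} → Matrix (Fin 2 ⊕ Fin 2) (Fin 2 ⊕ Fin 2) ℂ → ℂ)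
    (hFs : ∀ s r w, IsArchSiegelSection (fun z : ℂ => (conj z / ((‖z‖ : ℝ) : ℂ)) ^ (k w)) s (Fs s r w))
    (hQ : ∀ s r w, ∀ (v : Matrix (Fin 2) (Fin 2) ℂ), vᴴ * v = 1 → ∀ hv : v.det ≠ 0,
      (Fs s r w) ((2 : ℂ)⁻¹ • fromBlocks (1 + v) (-(I • (1 - v))) (I • (1 - v)) (1 + v) : Matrix (Fin 2 ⊕ Fin 2) (Fin 2 ⊕ Fin 2) ℂ) = evalAt v hv (Q r w))
    (g : UnitaryGroup.arch (Fp L) L (IsCMField.complexConj L) (2 + 2) (hermD L e dV hdV dW hdW))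
    (F : ℂ → UnitaryGroup.arch (Fp L) L (IsCMField.complexConj L) (2 + 2) (hermD L e dV hdV dW hdW) → ℂ)
    (hpres : ∀ (s : ℂ) (a : UnitaryGroup.arch (Fp L) L (IsCMField.complexConj L) (2 + 2) (hermD L e dV hdV dW hdW)),
      F s a = ∑ r, γ r s * ∏ w, Fs s r w (Fr (a * g) w))
    (κinf : UnitaryGroup.arch (Fp L) L (IsCMField.complexConj L) (2 + 2) (hermD L e dV hdV dW hdW)) :
    (∀ s : ℂ, 1 < s.re → Integrable (fun p : ↥(unipDeltaArch L e dV hdV dW hdW) =>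
      F s (UnitaryGroup.archPart (Fp L) L (IsCMField.complexConj L) (2 + 2) (hermD L e dV hdV dW hdW) (weylDelta L e dV hdV dW hdW) *
        (p : UnitaryGroup.arch (Fp L) L (IsCMField.complexConj L) (2 + 2) (hermD L e dV hdV dW hdW)) * κinf)) νinf) ∧
    ∃ E : ℂ → ℂ, DifferentiableOn ℂ E {s : ℂ | 0 < s.re} ∧ ∀ s : ℂ, 1 < s.re →
      ∫ p : ↥(unipDeltaArch L e dV hdV dW hdW),
        F s (UnitaryGroup.archPart (Fp L) L (IsCMField.complexConj L) (2 + 2) (hermD L e dV hdV dW hdW) (weylDelta L e dV hdV dW hdW) *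
          (p : UnitaryGroup.arch (Fp L) L (IsCMField.complexConj L) (2 + 2) (hermD L e dV hdV dW hdW)) * κinf) ∂νinf = E s := by
  -- ★ §5 per summand `r`, at the point `κ_∞ · g`
  have hE := fun r : Fin m => exists_continuation_integral_unipDeltaArch_of_record L e dV hdV dW hdW T Tinv Fr hFr hT2 hTU hT1 hTiv hTN νinf B C hBC k hk (Q r) (κinf * g)
  choose E hEd hEval using hE
  have hInt := fun (r : Fin m) {s : ℂ} (hs : 1 / 2 < s.re) =>
    integrable_prod_unipDeltaArch_of_record L e dV hdV dW hdW T Tinv Fr hFr hT2 hTU hT1 hTiv hTN νinf B C hBC k (Q r) (κinf * g) hs (Fs s r) (hFs s r) (hQ s r)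
  -- the integrand, summand by summand
  have hF : ∀ (s : ℂ) (p : ↥(unipDeltaArch L e dV hdV dW hdW)),
      F s (UnitaryGroup.archPart (Fp L) L (IsCMField.complexConj L) (2 + 2) (hermD L e dV hdV dW hdW) (weylDelta L e dV hdV dW hdW) *
          (p : UnitaryGroup.arch (Fp L) L (IsCMField.complexConj L) (2 + 2) (hermD L e dV hdV dW hdW)) * κinf) =
        ∑ r, γ r s * ∏ w, Fs s r w (Fr (UnitaryGroup.archPart (Fp L) L (IsCMField.complexConj L) (2 + 2) (hermD L e dV hdV dW hdW) (weylDelta L e dV hdV dW hdW) *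
          (p : UnitaryGroup.arch (Fp L) L (IsCMField.complexConj L) (2 + 2) (hermD L e dV hdV dW hdW)) * (κinf * g)) w) := fun s p => by
    rw [hpres, mul_assoc _ κinf g]
  refine ⟨fun s hs => ?_, ⟨fun s => ∑ r, γ r s * E r s, ?_, fun s hs => ?_⟩⟩
  · -- (7a) integrability: a finite sum of constant multiples of §5's integrable products
    have hs' : 1 / 2 < s.re := by linarith
    refine (integrable_finsetSum (Finset.univ : Finset (Fin m)) fun r _ => (hInt r hs').const_mul (γ r s)).congr
      (Filter.Eventually.of_forall fun p => ?_)
    exact (hF s p).symm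
  · -- holomorphy of `E := Σ_r γ_r · E_r`
    exact DifferentiableOn.fun_sum fun r _ => (hγ r).mul (hEd r)
  · -- (7b) the value
    have hs' : 1 / 2 < s.re := by linarith
    simp_rw [hF s]
    rw [integral_finsetSum _ fun r _ => (hInt r hs').const_mul (γ r s)]
    refine Finset.sum_congr rfl fun r _ => ?_
    rw [integral_const_mul, hEval r s hs' (Fs s r) (hFs s r) (hQ s r)]

end Summit.HodgeConjecture.HodgeConjecture.Cruxes.HLiu418.K2LiuArchFaceOfPresentation

end
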